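import Mathlib
import Summits.KontsevichZagierPeriods.KontsevichZagierPeriods.Theorems.SoloInformedHesseRho
import Literature.NumberTheory.Transcendental.KZCalculus
import Literature.NumberTheory.Transcendental.KZMellinFibres
import Literature.NumberTheory.Transcendental.SemialgebraicMaps
import Literature.NumberTheory.Transcendental.SemialgebraicMapsProofs
import Literature.NumberTheory.Transcendental.SemialgebraicVolume
import HarnessLib
import HarnessLib.Audit

/-!
# SoloInformed — Gauss triplication by the moves, III: the tangential chart `Ψ : C₀ → B₃′`

The tangential map `Ψ` of the pencil `xyz = F`, `x+y+z = 1` (`SoloInformedHesseTangential`) is a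
`ℚ`-rational map of the plane; restricted to the Weyl chamber
`C₀ = {0 < x < z < y}` (`z = 1−x−y`) it is a differentiable bijection onto the outer region
`B₃′ = {x < 0, y < 0, xy(1−x−y) < 1/27}` with Jacobian determinant identically `−2`
(`soloInformed_hesseChart`). Injectivity: `F∘Ψ = F`, `Ψ_x = ρ_F(x)` and `ρ_F` is injective on the
`x`-range (`SoloInformedHesseRho`); surjectivity: `ρ_F` is onto `(−∞,0)`, the upper sheet lies in
`C₀`, and a point of `B₃′` is determined by `(x, F)`.

These are exactly the data of Kontsevich–Zagier's rule (2) (`KZ.changeOfVariablesRel`).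
Residency `solo-KontsevichZagierPeriods-informed` (s71); paper §7 (c6)(x).
References: Kontsevich–Zagier, *Periods* (2001), §1.2 rule (2); Silverman, AEC III.2.
-/

noncomputable section

open MeasureTheory Set Filter
namespace Summit.KontsevichZagierPeriods.KontsevichZagierPeriods.Theorems

open Literature.NumberTheory.Transcendental Literature.NumberTheory.Transcendental.KZ
open Literature.ModelTheory.ExponentialFields

/-! ### The two regions -/

/-- The Weyl chamber `C₀ = {0 < x < z < y}`, `z = 1 − x − y` (`x` minimal, `z` the median).
[this work] -/
def soloInformedC0 : Set (Fin 2 → ℝ) :=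
  {z | 0 < z 0 ∧ z 0 < 1 - z 0 - z 1 ∧ 1 - z 0 - z 1 < z 1}

/-- The outer region `B₃′ = {x < 0, y < 0, xy(1−x−y) < 1/27}` (between the branch asymptotic to
the third side and the level `F = 1/27`). [this work] -/
def soloInformedB3 : Set (Fin 2 → ℝ) :=
  {w | w 0 < 0 ∧ w 1 < 0 ∧ w 0 * w 1 * (1 - w 0 - w 1) < 1 / 27}

/-- `C₀` is `ℚ`-semialgebraic. [this work] -/
theorem soloInformed_isSemialgebraic_C0 : IsSemialgebraic ℚ soloInformedC0 := by
  have h := isSemialgebraic_setOf_forall_aeval_pos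
    ![(MvPolynomial.X 0 : MvPolynomial (Fin 2) ℚ), 1 - MvPolynomial.C 2 * MvPolynomial.X 0 - MvPolynomial.X 1,
      MvPolynomial.X 0 + MvPolynomial.C 2 * MvPolynomial.X 1 - 1]
  convert h using 1
  ext z
  simp only [soloInformedC0, mem_setOf_eq, Fin.forall_fin_succ, Matrix.cons_val_zero,
    Matrix.cons_val_succ, map_sub, map_add, map_mul, map_one, MvPolynomial.aeval_X,
    MvPolynomial.aeval_C, eq_ratCast, Rat.cast_ofNat]
  constructor
  · rintro ⟨h0, h1, h2⟩; exact ⟨h0, by linarith, by linarith, fun i => Fin.elim0 i⟩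
  · rintro ⟨h0, h1, h2, -⟩; exact ⟨h0, by linarith, by linarith⟩

/-- `B₃′` is `ℚ`-semialgebraic. [this work] -/
theorem soloInformed_isSemialgebraic_B3 : IsSemialgebraic ℚ soloInformedB3 := by
  have h := isSemialgebraic_setOf_forall_aeval_pos
    ![(-MvPolynomial.X 0 : MvPolynomial (Fin 2) ℚ), -MvPolynomial.X 1,
      MvPolynomial.C (1 / 27) - MvPolynomial.X 0 * MvPolynomial.X 1 * (1 - MvPolynomial.X 0 - MvPolynomial.X 1)]
  convert h using 1
  ext z
  simp only [soloInformedB3, mem_setOf_eq, Fin.forall_fin_succ, Matrix.cons_val_zero,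
    Matrix.cons_val_succ, map_sub, map_mul, map_neg, map_one, MvPolynomial.aeval_X,
    MvPolynomial.aeval_C, eq_ratCast, Rat.cast_div, Rat.cast_one, Rat.cast_ofNat]
  constructor
  · rintro ⟨h0, h1, h2⟩; exact ⟨by linarith, by linarith, by linarith, fun i => Fin.elim0 i⟩
  · rintro ⟨h0, h1, h2, -⟩; exact ⟨by linarith, by linarith, by linarith⟩

/-- `C₀` is measurable. [this work] -/
theorem soloInformed_measurableSet_C0 : MeasurableSet soloInformedC0 :=
  soloInformed_isSemialgebraic_C0.measurableSet_holds

/-- `B₃′` is measurable. [this work] -/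
theorem soloInformed_measurableSet_B3 : MeasurableSet soloInformedB3 :=
  soloInformed_isSemialgebraic_B3.measurableSet_holds

/-- On `C₀` the `x`-coordinate lies in the range `S_F`, `F = F(x,y)`. [this work] -/
theorem soloInformed_mem_rhoDom_of_C0 {x y : ℝ} (hx : 0 < x) (hxz : x < 1 - x - y)
    (hzy : 1 - x - y < y) : x ∈ soloInformedRhoDom (soloInformedHesseF x y) := by
  refine ⟨hx, by linarith, ?_, ?_⟩
  · unfold soloInformedHesseF
    -- x(1-2x) < y z  since  yz - x(1-2x) = (z - x)(y - x)... with y+z = 1-x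
    have : x * y * (1 - x - y) - x ^ 2 * (1 - 2 * x) = x * ((1 - x - y - x) * (y - x)) := by ring
    nlinarith [mul_pos hx (mul_pos (sub_pos.2 (by linarith : x < 1 - x - y)) (sub_pos.2 (by linarith : x < y)))]
  · unfold soloInformedHesseF
    have : x * (1 - x) ^ 2 - 4 * (x * y * (1 - x - y)) = x * (y - (1 - x - y)) ^ 2 := by ring
    nlinarith [mul_pos hx (pow_pos (sub_pos.2 hzy) 2)]

/-! ### A quotient rule for Fréchet derivatives of real functions -/

/-- Quotient rule: `D(c/d) = (d x)⁻¹ • Dc + (−c x/(d x)²) • Dd`. [folklore] -/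
theorem soloInformed_hasFDerivAt_div {E : Type*} [NormedAddCommGroup E] [NormedSpace ℝ E]
    {c d : E → ℝ} {c' d' : E →L[ℝ] ℝ} {x : E}
    (hc : HasFDerivAt c c' x) (hd : HasFDerivAt d d' x) (hx : d x ≠ 0) :
    HasFDerivAt (fun y => c y / d y) ((d x)⁻¹ • c' + (-(c x) / (d x) ^ 2) • d') x := by
  have hinv : HasFDerivAt (fun y => (d y)⁻¹) ((-(d x ^ 2)⁻¹) • d') x :=
    (hasDerivAt_inv hx).comp_hasFDerivAt x hd
  have h := hc.fun_mul hinv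
  have e : (fun y => c y / d y) = fun y => c y * (d y)⁻¹ := funext fun y => div_eq_mul_inv _ _
  rw [e]
  refine h.congr_fderiv (ContinuousLinearMap.ext fun v => ?_)
  simp only [add_apply, smul_apply, smul_eq_mul]
  ring

/-! ### The chart -/

/-- The tangential map as a self-map of `ℝ²`. [this work] -/
def soloInformedTan (z : Fin 2 → ℝ) : Fin 2 → ℝ := ![soloInformedTanX (z 0) (z 1), soloInformedTanY (z 0) (z 1)]

/-- Its Jacobian matrix as a continuous linear map. [this work] -/
def soloInformedTanD (z : Fin 2 → ℝ) : (Fin 2 → ℝ) →L[ℝ] (Fin 2 → ℝ) :=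
  LinearMap.toContinuousLinearMap (Matrix.toLin'
    !![soloInformedTanJ11 (z 0) (z 1), soloInformedTanJ12 (z 0) (z 1);
       soloInformedTanJ21 (z 0) (z 1), soloInformedTanJ22 (z 0) (z 1)])

/-- First component of `Ψ`. [this work] -/
theorem soloInformedTan_zero (z : Fin 2 → ℝ) : soloInformedTan z 0 = soloInformedTanX (z 0) (z 1) := rfl
/-- Second component of `Ψ`. [this work] -/
theorem soloInformedTan_one (z : Fin 2 → ℝ) : soloInformedTan z 1 = soloInformedTanY (z 0) (z 1) := rfl

/-- First row of `DΨ`. [this work] -/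
theorem soloInformedTanD_apply_zero (z v : Fin 2 → ℝ) :
    soloInformedTanD z v 0 = soloInformedTanJ11 (z 0) (z 1) * v 0 + soloInformedTanJ12 (z 0) (z 1) * v 1 := by
  change Matrix.toLin' !![soloInformedTanJ11 (z 0) (z 1), soloInformedTanJ12 (z 0) (z 1);
    soloInformedTanJ21 (z 0) (z 1), soloInformedTanJ22 (z 0) (z 1)] v 0 = _
  rw [Matrix.toLin'_apply]
  simp [Matrix.mulVec, dotProduct, Fin.sum_univ_two]

/-- Second row of `DΨ`. [this work] -/
theorem soloInformedTanD_apply_one (z v : Fin 2 → ℝ) :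
    soloInformedTanD z v 1 = soloInformedTanJ21 (z 0) (z 1) * v 0 + soloInformedTanJ22 (z 0) (z 1) * v 1 := by
  change Matrix.toLin' !![soloInformedTanJ11 (z 0) (z 1), soloInformedTanJ12 (z 0) (z 1);
    soloInformedTanJ21 (z 0) (z 1), soloInformedTanJ22 (z 0) (z 1)] v 1 = _
  rw [Matrix.toLin'_apply]
  simp [Matrix.mulVec, dotProduct, Fin.sum_univ_two]

/-- `det DΨ` in terms of the Jacobian entries. [this work] -/
theorem soloInformedTanD_det (z : Fin 2 → ℝ) :
    (soloInformedTanD z).det = soloInformedTanJ11 (z 0) (z 1) * soloInformedTanJ22 (z 0) (z 1) -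
      soloInformedTanJ12 (z 0) (z 1) * soloInformedTanJ21 (z 0) (z 1) := by
  change LinearMap.det (Matrix.toLin' !![soloInformedTanJ11 (z 0) (z 1), soloInformedTanJ12 (z 0) (z 1);
    soloInformedTanJ21 (z 0) (z 1), soloInformedTanJ22 (z 0) (z 1)]) = _
  rw [LinearMap.det_toLin', Matrix.det_fin_two]
  simp

/-- `Ψ` is a `ℚ`-semialgebraic (indeed `ℚ`-rational) map on `C₀`. [this work] -/
theorem soloInformed_isSemialgebraicMapOn_tan : IsSemialgebraicMapOn ℚ soloInformedC0 soloInformedTan := by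
  have hC := soloInformed_isSemialgebraic_C0
  refine IsSemialgebraicMapOn.of_forall hC (Fin.forall_fin_two.mpr ⟨?_, ?_⟩)
  · refine (isSemialgebraicFunOn_aeval_div_aeval hC
      (-MvPolynomial.X 0 * (MvPolynomial.X 0 + MvPolynomial.C 2 * MvPolynomial.X 1 - 1) ^ 2)
      ((MvPolynomial.X 0 - MvPolynomial.X 1) * (MvPolynomial.C 2 * MvPolynomial.X 0 + MvPolynomial.X 1 - 1))
      fun z hz => ?_).congr fun z hz => ?_
    · obtain ⟨h0, h1, h2⟩ := hz
      have hd : z 0 - z 1 ≠ 0 := by intro h; linarith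
      have hn : 2 * z 0 + z 1 - 1 ≠ 0 := by intro h; linarith
      simpa using mul_ne_zero hd hn
    · simp [soloInformedTan_zero, soloInformedTanX]
  · refine (isSemialgebraicFunOn_aeval_div_aeval hC
      (MvPolynomial.X 1 * (MvPolynomial.C 2 * MvPolynomial.X 0 + MvPolynomial.X 1 - 1) ^ 2)
      ((MvPolynomial.X 0 - MvPolynomial.X 1) * (MvPolynomial.X 0 + MvPolynomial.C 2 * MvPolynomial.X 1 - 1))
      fun z hz => ?_).congr fun z hz => ?_
    · obtain ⟨h0, h1, h2⟩ := hz
      have hd : z 0 - z 1 ≠ 0 := by intro h; linarith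
      have hm : z 0 + 2 * z 1 - 1 ≠ 0 := by intro h; linarith
      simpa using mul_ne_zero hd hm
    · simp [soloInformedTan_one, soloInformedTanY]

/-- `Ψ` is differentiable off the three lines `x = y`, `x = z`, `y = z`, with derivative the
matrix `J`. [this work] -/
theorem soloInformed_hasFDerivAt_tan {z : Fin 2 → ℝ} (hd : z 0 - z 1 ≠ 0) (hm : z 0 + 2 * z 1 - 1 ≠ 0)
    (hn : 2 * z 0 + z 1 - 1 ≠ 0) : HasFDerivAt soloInformedTan (soloInformedTanD z) z := by
  have hn' : z 0 * 2 + z 1 - 1 ≠ 0 := fun h => hn (by linarith)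
  have hm' : z 0 + z 1 * 2 - 1 ≠ 0 := fun h => hm (by linarith)
  have h0 : HasFDerivAt (fun y : Fin 2 → ℝ => y 0)
      (ContinuousLinearMap.proj (R := ℝ) (φ := fun _ : Fin 2 => ℝ) 0) z := hasFDerivAt_apply 0 z
  have h1 : HasFDerivAt (fun y : Fin 2 → ℝ => y 1)
      (ContinuousLinearMap.proj (R := ℝ) (φ := fun _ : Fin 2 => ℝ) 1) z := hasFDerivAt_apply 1 z
  have hdd := h0.sub h1
  have hmm := (h0.add (h1.const_mul (2:ℝ))).sub_const (1:ℝ)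
  have hnn := ((h0.const_mul (2:ℝ)).add h1).sub_const (1:ℝ)
  rw [hasFDerivAt_pi']
  refine Fin.forall_fin_two.mpr ⟨?_, ?_⟩
  · have hN := h0.neg.fun_mul (hmm.fun_mul hmm)
    have hQ := hdd.fun_mul hnn
    have hQz : (z 0 - z 1) * (2 * z 0 + z 1 - 1) ≠ 0 := mul_ne_zero hd hn
    have h := soloInformed_hasFDerivAt_div hN hQ hQz
    have e : (fun y : Fin 2 → ℝ => soloInformedTan y 0) =
        fun y => -y 0 * ((y 0 + 2 * y 1 - 1) * (y 0 + 2 * y 1 - 1)) / ((y 0 - y 1) * (2 * y 0 + y 1 - 1)) := by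
      funext y; rw [soloInformedTan_zero, soloInformedTanX, sq]
    rw [e]
    refine h.congr_fderiv (ContinuousLinearMap.ext fun v => ?_)
    simp only [ContinuousLinearMap.coe_comp, Function.comp_apply, ContinuousLinearMap.proj_apply,
      soloInformedTanD_apply_zero, add_apply, smul_apply, FunLike.coe_sub, Pi.sub_apply, Pi.add_apply,
      neg_apply, Pi.neg_apply, smul_eq_mul]
    unfold soloInformedTanJ11 soloInformedTanJ12
    field_simp
    ring
  · have hN := h1.fun_mul (hnn.fun_mul hnn)
    have hQ := hdd.fun_mul hmm
    have hQz : (z 0 - z 1) * (z 0 + 2 * z 1 - 1) ≠ 0 := mul_ne_zero hd hm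
    have h := soloInformed_hasFDerivAt_div hN hQ hQz
    have e : (fun y : Fin 2 → ℝ => soloInformedTan y 1) =
        fun y => y 1 * ((2 * y 0 + y 1 - 1) * (2 * y 0 + y 1 - 1)) / ((y 0 - y 1) * (y 0 + 2 * y 1 - 1)) := by
      funext y; rw [soloInformedTan_one, soloInformedTanY, sq]
    rw [e]
    refine h.congr_fderiv (ContinuousLinearMap.ext fun v => ?_)
    simp only [ContinuousLinearMap.coe_comp, Function.comp_apply, ContinuousLinearMap.proj_apply,
      soloInformedTanD_apply_one, add_apply, smul_apply, FunLike.coe_sub, Pi.sub_apply, Pi.add_apply,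
      smul_eq_mul]
    unfold soloInformedTanJ21 soloInformedTanJ22
    field_simp
    ring

/-- `Ψ` is injective on `C₀`. [this work] -/
theorem soloInformed_injOn_tan : InjOn soloInformedTan soloInformedC0 := by
  rintro z ⟨hx, hxz, hzy⟩ z' ⟨hx', hxz', hzy'⟩ h
  have e0 : soloInformedTanX (z 0) (z 1) = soloInformedTanX (z' 0) (z' 1) := by
    have := congrFun h 0; rwa [soloInformedTan_zero, soloInformedTan_zero] at this
  have e1 : soloInformedTanY (z 0) (z 1) = soloInformedTanY (z' 0) (z' 1) := by
    have := congrFun h 1; rwa [soloInformedTan_one, soloInformedTan_one] at this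
  have hd : z 0 - z 1 ≠ 0 := by intro h; linarith
  have hm : z 0 + 2 * z 1 - 1 ≠ 0 := by intro h; linarith
  have hn : 2 * z 0 + z 1 - 1 ≠ 0 := by intro h; linarith
  have hd' : z' 0 - z' 1 ≠ 0 := by intro h; linarith
  have hm' : z' 0 + 2 * z' 1 - 1 ≠ 0 := by intro h; linarith
  have hn' : 2 * z' 0 + z' 1 - 1 ≠ 0 := by intro h; linarith
  -- same level F
  have hF : soloInformedHesseF (z 0) (z 1) = soloInformedHesseF (z' 0) (z' 1) := by
    rw [← soloInformed_hesseF_tan hd hm hn, ← soloInformed_hesseF_tan hd' hm' hn', e0, e1]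
  -- same x
  have hxx : z 0 = z' 0 := by
    have hF0 : 0 < soloInformedHesseF (z 0) (z 1) :=
      soloInformed_hesseF_pos hx (by linarith) (by linarith)
    rw [soloInformed_tanX_eq_rho hx.ne' hd hn, soloInformed_tanX_eq_rho hx'.ne' hd' hn', ← hF] at e0
    exact soloInformed_rho_injOn hF0 (soloInformed_mem_rhoDom_of_C0 hx hxz hzy)
      (hF ▸ soloInformed_mem_rhoDom_of_C0 hx' hxz' hzy') e0
  -- same y
  have hyy : z 1 = z' 1 := by
    unfold soloInformedHesseF at hF
    rw [← hxx] at hF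
    have h2 : (z 1 - z' 1) * (1 - z 0 - z 1 - z' 1) = 0 := by
      have : z 0 * ((z 1 - z' 1) * (1 - z 0 - z 1 - z' 1)) = 0 := by nlinarith
      simpa [hx.ne'] using this
    rcases mul_eq_zero.1 h2 with h2 | h2
    · linarith
    · exfalso
      rw [← hxx] at hxz' hzy'
      linarith
  funext i
  fin_cases i
  · exact hxx
  · exact hyy

/-- `Ψ(C₀) = B₃′`. [this work] -/
theorem soloInformed_image_tan : soloInformedTan '' soloInformedC0 = soloInformedB3 := by
  ext w
  constructor
  · rintro ⟨z, ⟨hx, hxz, hzy⟩, rfl⟩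
    have hd : z 0 - z 1 ≠ 0 := by intro h; linarith
    have hm : z 0 + 2 * z 1 - 1 ≠ 0 := by intro h; linarith
    have hn : 2 * z 0 + z 1 - 1 ≠ 0 := by intro h; linarith
    refine ⟨?_, ?_, ?_⟩
    · rw [soloInformedTan_zero]; exact soloInformed_tanX_neg hx hxz hzy
    · rw [soloInformedTan_one]; exact soloInformed_tanY_neg hx hxz hzy
    · have h := soloInformed_hesseF_tan hd hm hn
      unfold soloInformedHesseF at h
      rw [soloInformedTan_zero, soloInformedTan_one, h]
      exact soloInformed_hesseF_lt hx (by linarith) (by linarith) (by intro h'; linarith)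
  · rintro ⟨hw0, hw1, hwF⟩
    set F := soloInformedHesseF (w 0) (w 1) with hFdef
    have hF0 : 0 < F := by
      rw [hFdef]; unfold soloInformedHesseF
      have : 0 < w 0 * w 1 := mul_pos_of_neg_of_neg hw0 hw1
      nlinarith
    have hF1 : F < 1 / 27 := hwF
    obtain ⟨x, hxdom, hρ⟩ := soloInformed_rho_surj hF0 hF1 hw0
    obtain ⟨hFxy, hxz, hzy⟩ := soloInformed_upperSheet hxdom
    set y := ((1 - x) + Real.sqrt ((1 - x) ^ 2 - 4 * F / x)) / 2 with hy
    have hx : 0 < x := hxdom.1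
    have hd : x - y ≠ 0 := by intro h; linarith
    have hm : x + 2 * y - 1 ≠ 0 := by intro h; linarith
    have hn : 2 * x + y - 1 ≠ 0 := by intro h; linarith
    refine ⟨![x, y], ⟨hx, hxz, hzy⟩, ?_⟩
    have hX : soloInformedTanX x y = w 0 := by
      rw [soloInformed_tanX_eq_rho hx.ne' hd hn, hFxy, hρ]
    have hY : soloInformedTanY x y = w 1 := by
      have h := soloInformed_hesseF_tan hd hm hn
      rw [hX, hFxy] at h
      exact soloInformed_negRoot_unique hw0 (soloInformed_tanY_neg hx hxz hzy) hw1 h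
    funext i
    fin_cases i
    · simpa [soloInformedTan] using hX
    · simpa [soloInformedTan] using hY

/-- `|det DΨ| = 2` on `C₀`. [this work] -/
theorem soloInformed_abs_det_tanD {z : Fin 2 → ℝ} (hz : z ∈ soloInformedC0) : |(soloInformedTanD z).det| = 2 := by
  obtain ⟨hx, hxz, hzy⟩ := hz
  have hd : z 0 - z 1 ≠ 0 := by intro h; linarith
  have hm : z 0 + 2 * z 1 - 1 ≠ 0 := by intro h; linarith
  have hn : 2 * z 0 + z 1 - 1 ≠ 0 := by intro h; linarith
  rw [soloInformedTanD_det, soloInformed_tanJ_det hd hm hn]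
  norm_num

/-- **The tangential chart**, all the data of rule (2): `Ψ` is `ℚ`-semialgebraic on `C₀`,
differentiable there with derivative `J`, injective, onto `B₃′`, with `|det J| = 2`. [this work] -/
theorem soloInformed_hesseChart :
    IsSemialgebraicMapOn ℚ soloInformedC0 soloInformedTan ∧
      (∀ z ∈ soloInformedC0, HasFDerivAt soloInformedTan (soloInformedTanD z) z) ∧
      InjOn soloInformedTan soloInformedC0 ∧ soloInformedTan '' soloInformedC0 = soloInformedB3 ∧
      ∀ z ∈ soloInformedC0, |(soloInformedTanD z).det| = 2 := by
  refine ⟨soloInformed_isSemialgebraicMapOn_tan, fun z hz => ?_, soloInformed_injOn_tan,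
    soloInformed_image_tan, fun z hz => soloInformed_abs_det_tanD hz⟩
  obtain ⟨hx, hxz, hzy⟩ := hz
  exact soloInformed_hasFDerivAt_tan (by intro h; linarith) (by intro h; linarith) (by intro h; linarith)

end Summit.KontsevichZagierPeriods.KontsevichZagierPeriods.Theorems
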